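/-
Copyright: b2b-lace packet (carver, gen 14).  The FAR-NODE bound for the SRW integral `K_{1,l}(x)`
at lattice nodes `x` outside the tabulated box (LEMMAS §20 node N66; enum1-g4 `WBX.md` §2 (E3),
`kfar.py`) as a typed dictionary over tree theorems, plus the parity vanishing of the SRW law.
-/
import Literature.Probability.FitznerVanDerHofstad2017.SrwIntegralJFarField
import HarnessLib

/-!
# The far-node bound `K_{1,l}(x)² ≤ I_{1,2l}(0) · (2^d d!)⁻¹ Σ_ρ [Σ_{i<N} p_i(x − ρx) + I_{1,N}(0)]`

[NoBLE17-I] R. Fitzner, R. van der Hofstad, *Generalized approach to the non-backtracking lace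
expansion*, PTRF 169 (2017) 1041–1119, §5.2, bounds the SRW integral
`K_{n,l}(x) = ∫ |D̂|^l Ĉⁿ |D̂^{(x)}| dk/(2π)^d` by Cauchy–Schwarz,
`K_{n,l}(x)² ≤ I_{n,2l}(0) · L_n(x)` ((5.9) p. 1091, tree theorem `srwK_le_sqrt_srwI_mul_srwL`),
and computes `L_n(x) = (2^d d!)⁻¹ Σ_{ρ ∈ W_d} I_{n,0}(x − ρx)` ((5.16) p. 1092, tree theorem
`srwW_eq_orbit_sum` with `srwW_zero`).  The Mathematica implementation tabulates `K_{n,l}(x)` only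
on a finite box of nodes.  The b2b-lace bound variant WBX(M) (weighted-bubble extraction to a general
cut `M`, LEMMAS §20) needs `K_{1,l}(x_v)` at every endpoint type `v` with `|v|₁ ≤ M ≤ 16`, i.e. far
outside the box; enum1-g4's `kfar.py` bounds it there by the chain (P1)–(P5) of `WBX.md` §2 (E3).
This file records that chain as theorems over the tree's definitions, so that a certifying engine
instantiates NAMED statements with outward-rounded numbers:

* `srwLaw_eq_zero_of_odd` — PARITY VANISHING `p_n(x) = 0` whenever `n + |x|₁` is odd (simple random
  walk is bipartite; induction on the one-step recursion, as `srwLaw_eq_zero_of_lt`);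
  `srwI_zero_eq_zero_of_odd` is the same for `I_{0,j} = p_j`.
* `srwI_le_srwI_zero` — `I_{n,l}(x) ≤ I_{n,l}(0)` (`n ≥ 1`, `d ≥ 2n+1`): the origin dominates, from
  Lemma M (`absMonotone_srwI`, = [HS92b] Lemma B.3 for the tails `I_{1,l} = Σ_{i ≥ l} p_i`).
* `srwI_one_eq_sum_add` / `srwI_one_le_sum_add_zero` — the Green-function value split into an exact
  finite part and a tail dominated at the origin:
  `I_{1,l}(w) = Σ_{i<N} p_{l+i}(w) + I_{1,l+N}(w) ≤ Σ_{i<N} p_{l+i}(w) + I_{1,l+N}(0)`;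
  `srwI_one_shift_zero_eq` — the tail at the origin is itself exact given `I_{1,l}(0)`:
  `I_{1,l+N}(0) = I_{1,l}(0) − Σ_{i<N} p_{l+i}(0)`; `srwI_one_le_succ_zero_of_odd` — the parity-sharp
  tail `I_{1,N}(w) ≤ I_{1,N+1}(0)` when `N + |w|₁` is odd.
* `srwL_eq_orbit_sum_srwI` — `L_n(x) = (2^d d!)⁻¹ Σ_ρ I_{n,0}(x − ρx)`; `srwL_le_of_orbit_majorant`,
  `srwK_le_of_orbit_majorant` — any termwise majorant `I_{n,0}(x − ρx) ≤ B ρ` gives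
  `K_{n,l}(x) ≤ √(I_{n,2l}(0)) · √((2^d d!)⁻¹ Σ_ρ B ρ)`.
* `srwK_one_le_farNode` — the assembled far-node bound for `n = 1`, `d ≥ 3`, every `x` and every
  truncation order `N`:
  `K_{1,l}(x) ≤ √(I_{1,2l}(0)) · √((2^d d!)⁻¹ Σ_ρ [Σ_{i<N} p_i(x − ρx) + I_{1,N}(0)])`.

Everything here is a consequence of tree theorems; the numerical premises an engine supplies
(`I_{1,2l}(0)`, `I_{1,N}(0) = I_{1,0}(0) − Σ_{i<N} p_i(0)`, the walk counts `(2d)^i p_i(w)`) are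
inputs, not proved here.  No statement about any dimension is made.
-/

namespace Literature.Probability.FitznerVanDerHofstad2017

open MeasureTheory Finset Real Filter Topology
open Literature.Barriers.CriticalPhenomena
open Literature.Barriers.CriticalPhenomena.LongRangePhi4 (srwLaw srwLaw_zero_apply srwLaw_succ_apply
  srwLaw_nonneg)
open Literature.Probability.LatticeModels

variable {d : ℕ}

/-! ### Parity vanishing of the SRW law -/

/-- One step flips the parity of `|x|₁`: `|x + e_j|₁ ≡ |x|₁ + 1 (mod 2)`. [folklore] -/
theorem sum_natAbs_add_single_mod_two (x : Fin d → ℤ) (j : Fin d) :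
    (∑ i, ((x + Pi.single j 1 : Fin d → ℤ) i).natAbs) % 2 = ((∑ i, (x i).natAbs) + 1) % 2 := by
  have h1 : ∑ i, ((x + Pi.single j 1 : Fin d → ℤ) i).natAbs =
      (x j + 1).natAbs + ∑ i ∈ univ.erase j, (x i).natAbs := by
    rw [← Finset.add_sum_erase _ _ (mem_univ j)]
    congr 1
    · simp
    · exact Finset.sum_congr rfl fun i hi => by
        rw [Pi.add_apply, Pi.single_eq_of_ne (ne_of_mem_erase hi), add_zero]
  have h2 : ∑ i, (x i).natAbs = (x j).natAbs + ∑ i ∈ univ.erase j, (x i).natAbs :=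
    (Finset.add_sum_erase _ _ (mem_univ j)).symm
  have h3 : (x j + 1).natAbs % 2 = ((x j).natAbs + 1) % 2 := by omega
  rw [h1, h2]
  omega

/-- One step flips the parity of `|x|₁`: `|x - e_j|₁ ≡ |x|₁ + 1 (mod 2)`. [folklore] -/
theorem sum_natAbs_sub_single_mod_two (x : Fin d → ℤ) (j : Fin d) :
    (∑ i, ((x - Pi.single j 1 : Fin d → ℤ) i).natAbs) % 2 = ((∑ i, (x i).natAbs) + 1) % 2 := by
  have h1 : ∑ i, ((x - Pi.single j 1 : Fin d → ℤ) i).natAbs =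
      (x j - 1).natAbs + ∑ i ∈ univ.erase j, (x i).natAbs := by
    rw [← Finset.add_sum_erase _ _ (mem_univ j)]
    congr 1
    · simp
    · exact Finset.sum_congr rfl fun i hi => by
        rw [Pi.sub_apply, Pi.single_eq_of_ne (ne_of_mem_erase hi), sub_zero]
  have h2 : ∑ i, (x i).natAbs = (x j).natAbs + ∑ i ∈ univ.erase j, (x i).natAbs :=
    (Finset.add_sum_erase _ _ (mem_univ j)).symm
  have h3 : (x j - 1).natAbs % 2 = ((x j).natAbs + 1) % 2 := by omega
  rw [h1, h2]
  omega

/-- **Parity vanishing** `pₙ(x) = 0` whenever `n + |x|₁` is odd: simple random walk on `ℤ^d` is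
bipartite (induction on the recursion `p_{n+1}(x) = (2d)⁻¹ Σ_j [pₙ(x+e_j) + pₙ(x−e_j)]`, each step
flipping the parity of `|x|₁`). [folklore] -/
theorem srwLaw_eq_zero_of_odd (n : ℕ) :
    ∀ x : Fin d → ℤ, (n + ∑ i, (x i).natAbs) % 2 = 1 → srwLaw d n x = 0 := by
  induction n with
  | zero =>
    intro x hx
    rw [srwLaw_zero_apply, if_neg]
    rintro rfl
    simp at hx
  | succ n ih =>
    intro x hx
    rw [srwLaw_succ_apply]
    have h : ∀ j : Fin d, srwLaw d n (x + Pi.single j 1) + srwLaw d n (x - Pi.single j 1) = 0 := by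
      intro j
      have h1 := sum_natAbs_add_single_mod_two x j
      have h2 := sum_natAbs_sub_single_mod_two x j
      rw [ih _ (by omega), ih _ (by omega), add_zero]
    simp [h]

/-- `p_{2m+1}(0) = 0` (odd return times are impossible). [folklore] -/
theorem srwLaw_odd_zero (m : ℕ) : srwLaw d (2 * m + 1) 0 = 0 :=
  srwLaw_eq_zero_of_odd (2 * m + 1) 0 (by
    simp only [Pi.zero_apply, Int.natAbs_zero, Finset.sum_const_zero, Nat.add_zero]
    omega)

/-- `I_{0,j}(x) = p_j(x) = 0` whenever `j + |x|₁` is odd.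
[cite: FitznerVanDerHofstad2016NoBLE, (5.1) p. 1090 ("the I_{0,m} (walk counts p_m(x))")] -/
theorem srwI_zero_eq_zero_of_odd (j : ℕ) (x : Fin d → ℤ) (h : (j + ∑ i, (x i).natAbs) % 2 = 1) :
    srwI d 0 j x = 0 := by
  rw [srwI_zero_eq_srwLaw]
  exact srwLaw_eq_zero_of_odd j x h

/-! ### The origin dominates: `I_{n,l}(x) ≤ I_{n,l}(0)` -/

/-- **`I_{n,l}(x) ≤ I_{n,l}(0)`** for `n ≥ 1`, `d ≥ 2n+1`, every `l` and every `x`: the case `z' = 0`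
of Lemma M (`absMonotone_srwI`: `I_{n,l}` is non-increasing in each `|x_μ|`).
[cite: HaraSlade1992b, App. B Lemma B.3] -/
theorem srwI_le_srwI_zero {n : ℕ} (hn : 1 ≤ n) (hd : 2 * n + 1 ≤ d) (l : ℕ) (x : Fin d → ℤ) :
    srwI d n l x ≤ srwI d n l 0 :=
  absMonotone_srwI hn hd l x 0 fun μ => by simp

/-- Lemma M at `n = 1`, `d ≥ 3`: the tails `I_{1,l} = Σ_{i ≥ l} p_i` are non-increasing in each
`|x_μ|`. [cite: HaraSlade1992b, App. B Lemma B.3] -/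
theorem absMonotone_srwI_one (hd : 3 ≤ d) (l : ℕ) : AbsMonotone (srwI d 1 l) :=
  absMonotone_srwI le_rfl (by omega) l

/-! ### The Green-function value: exact finite part plus a tail dominated at the origin -/

/-- **Finite part + tail**: `I_{1,l}(w) = Σ_{i<N} p_{l+i}(w) + I_{1,l+N}(w)` (`d ≥ 3`).
[cite: FitznerVanDerHofstad2016NoBLE, (5.1) p. 1090] -/
theorem srwI_one_eq_sum_add (hd : 3 ≤ d) (l N : ℕ) (w : Fin d → ℤ) :
    srwI d 1 l w = (∑ i ∈ Finset.range N, srwLaw d (l + i) w) + srwI d 1 (l + N) w := by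
  have hd' : 2 * (0 + 1) + 1 ≤ d := by omega
  have h := srwI_succ_telescope hd' l w N
  simp only [Nat.zero_add, srwI_zero_eq_srwLaw] at h
  exact h

/-- **The far tail is dominated at the origin**:
`I_{1,l}(w) ≤ Σ_{i<N} p_{l+i}(w) + I_{1,l+N}(0)` (`d ≥ 3`; `kfar.py`'s `Cb(w) ≥ C(w)` at `l = 0`).
[cite: HaraSlade1992b, App. B Lemma B.3] -/
theorem srwI_one_le_sum_add_zero (hd : 3 ≤ d) (l N : ℕ) (w : Fin d → ℤ) :
    srwI d 1 l w ≤ (∑ i ∈ Finset.range N, srwLaw d (l + i) w) + srwI d 1 (l + N) 0 := by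
  rw [srwI_one_eq_sum_add hd l N w]
  gcongr
  exact srwI_le_srwI_zero le_rfl (by omega) (l + N) w

/-- **The tail at the origin is exact given `I_{1,l}(0)`**:
`I_{1,l+N}(0) = I_{1,l}(0) − Σ_{i<N} p_{l+i}(0)` (`d ≥ 3`; `kfar.py`'s `E(N) = C(0) − Σ_{m<N} p_m(0)`).
[cite: FitznerVanDerHofstad2016NoBLE, (5.1) p. 1090] -/
theorem srwI_one_shift_zero_eq (hd : 3 ≤ d) (l N : ℕ) :
    srwI d 1 (l + N) 0 = srwI d 1 l 0 - ∑ i ∈ Finset.range N, srwLaw d (l + i) 0 := by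
  have h := srwI_one_eq_sum_add hd l N 0
  linarith

/-- **Parity-sharp tail**: if `N + |w|₁` is odd then `p_N(w) = 0`, so
`I_{1,N}(w) = I_{1,N+1}(w) ≤ I_{1,N+1}(0)` (`d ≥ 3`). [cite: HaraSlade1992b, App. B Lemma B.3] -/
theorem srwI_one_le_succ_zero_of_odd (hd : 3 ≤ d) (N : ℕ) (w : Fin d → ℤ)
    (h : (N + ∑ i, (w i).natAbs) % 2 = 1) : srwI d 1 N w ≤ srwI d 1 (N + 1) 0 := by
  have h1 := srwI_one_eq_sum_add hd N 1 w
  rw [Finset.sum_range_one, Nat.add_zero, srwLaw_eq_zero_of_odd N w h, zero_add] at h1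
  rw [h1]
  exact srwI_le_srwI_zero le_rfl (by omega) (N + 1) w

/-! ### `L_n` as an orbit sum and the far-node bound for `K_{n,l}` -/

/-- **`L_n(x) = (2^d d!)⁻¹ Σ_{ρ ∈ W_d} I_{n,0}(x − ρx)`** (`d ≥ 2n+1`): (5.16) at `j = 0`
(`srwW_eq_orbit_sum`, `srwW_zero`). [cite: FitznerVanDerHofstad2016NoBLE, (5.16) p. 1092] -/
theorem srwL_eq_orbit_sum_srwI {n : ℕ} (hd : 2 * n + 1 ≤ d) (x : Fin d → ℤ) :
    srwL d n x =
      (∑ ρ : SgnPermPair d, srwI d n 0 (x - spAct ρ x)) / (2 ^ d * (d.factorial : ℝ)) := by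
  have h := srwW_eq_orbit_sum hd 0 x
  simp only [Nat.mul_zero] at h
  rw [← srwW_zero, h]

/-- **Termwise majorants of the orbit sum bound `L_n`**: if `I_{n,0}(x − ρx) ≤ B ρ` for every
`ρ ∈ W_d` then `L_n(x) ≤ (2^d d!)⁻¹ Σ_ρ B ρ`. [cite: FitznerVanDerHofstad2016NoBLE, (5.16) p. 1092] -/
theorem srwL_le_of_orbit_majorant {n : ℕ} (hd : 2 * n + 1 ≤ d) (x : Fin d → ℤ)
    (B : SgnPermPair d → ℝ) (hB : ∀ ρ, srwI d n 0 (x - spAct ρ x) ≤ B ρ) :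
    srwL d n x ≤ (∑ ρ : SgnPermPair d, B ρ) / (2 ^ d * (d.factorial : ℝ)) := by
  rw [srwL_eq_orbit_sum_srwI hd x]
  exact div_le_div_of_nonneg_right (Finset.sum_le_sum fun ρ _ => hB ρ) (by positivity)

/-- **`K_{n,l}(x) ≤ √(I_{n,2l}(0)) · √((2^d d!)⁻¹ Σ_ρ B ρ)`** for any termwise majorant
`I_{n,0}(x − ρx) ≤ B ρ` (`d ≥ 2n+1`): Cauchy–Schwarz (5.9) and the orbit sum (5.16).
[cite: FitznerVanDerHofstad2016NoBLE, (5.9) p. 1091] -/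
theorem srwK_le_of_orbit_majorant {n : ℕ} (hd : 2 * n + 1 ≤ d) (l : ℕ) (x : Fin d → ℤ)
    (B : SgnPermPair d → ℝ) (hB : ∀ ρ, srwI d n 0 (x - spAct ρ x) ≤ B ρ) :
    srwK d n l x ≤
      Real.sqrt (srwI d n (2 * l) 0) *
        Real.sqrt ((∑ ρ : SgnPermPair d, B ρ) / (2 ^ d * (d.factorial : ℝ))) :=
  (srwK_le_sqrt_srwI_mul_srwL hd l x).trans
    (mul_le_mul_of_nonneg_left (Real.sqrt_le_sqrt (srwL_le_of_orbit_majorant hd x B hB))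
      (Real.sqrt_nonneg _))

/-- **The far-node bound** (`n = 1`, `d ≥ 3`, every node `x`, every truncation order `N`):
`K_{1,l}(x) ≤ √(I_{1,2l}(0)) · √((2^d d!)⁻¹ Σ_{ρ ∈ W_d} [Σ_{i<N} p_i(x − ρx) + I_{1,N}(0)])` —
the exact walk-count part at each image point plus the common origin tail (enum1-g4 `kfar.py`
(P1)–(P5) before its shell-law coarsening; the images may instead be enumerated exactly).
[cite: FitznerVanDerHofstad2016NoBLE, (5.9) p. 1091] -/
theorem srwK_one_le_farNode (hd : 3 ≤ d) (l N : ℕ) (x : Fin d → ℤ) :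
    srwK d 1 l x ≤
      Real.sqrt (srwI d 1 (2 * l) 0) *
        Real.sqrt ((∑ ρ : SgnPermPair d,
            ((∑ i ∈ Finset.range N, srwLaw d i (x - spAct ρ x)) + srwI d 1 N 0)) /
          (2 ^ d * (d.factorial : ℝ))) := by
  refine srwK_le_of_orbit_majorant (by omega) l x _ fun ρ => ?_
  have h := srwI_one_le_sum_add_zero hd 0 N (x - spAct ρ x)
  simp only [Nat.zero_add] at h
  exact h

end Literature.Probability.FitznerVanDerHofstad2017
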